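import Summits.CriticalPhenomena.PercolationContinuityZ3.Theorems.Transplant.FKConnectivityAllQPat3Attach
import HarnessLib

/-!
# Connectivity correlation inequalities for `φ_{w,q}`, every `q > 0` — THE PLAIN SKELETON: peeling a list of skeleton edges off
# the configuration sum (census g39 §11 (ii), the «skeleton colourings φ» of the gluing engine)

Definitions + theorems file (`--supports stmt-CriticalPhenomena-4575`), census lineage (gen 40) of LANE 2's FK sub-programme; builds on
p205010 (kernel theorem, internal audit signed; external expert review pending).  No named facts, no sorries; standard axioms.

A SKELETON is a list `L` of named edges `(i, j)` (names `ι`, vertices `p : ι → V`), realised as the actual edges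
`FK.pedge p (i, j) = s(p i, p j)` (distinct, no loops); `FK.plainSet p L` is their edge set; a skeleton colouring is a bit list
`bs` (`FK.zipBits L bs` decorates the edges, `FK.sumBits n` enumerates the `2^n` lists — computable).
* `FK.sum_attachPatCC` — `FK.sum_attachPatC` of `…Pat3Attach` with contracted sets on BOTH sides (the form that iterates when the
  marked pieces of a shape are peeled one by one).
* `FK.foldBits R bits` (DEFINITION, computable) — `FK.attachBit` folded along the list, returning the final connectivity matrix of
  the names and the number of cycle-closing open edges (the level corrections).
* `FK.apExp_subset_singleton`, `FK.conn_subset_singleton` — the one-edge network: exponent `2|V| - 1`, bit `1{e open}`.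
* `FK.sum_insert_edge` — ONE skeleton edge under the configuration sum (`FK.sum_attachBit` of `…Pat3Attach` with the one-edge
  piece): level `+ 1 = +` the two corrections.
* **`FK.sum_plainList`** — ALL skeleton edges: for any summand `g` of (level, configuration matrix, complement matrix), the
  configuration sum over `E₁ ∪ plainSet p L` is the sum over host configurations `γ₁ ⊆ E₁` and bit lists `bs` (`FK.sumBits`)
  of `g` read on `foldBits` of the two host matrices (bits `bs` and their negations), the level shifted by the two correction counts.  With
  `E₁ = ∅` (`FK.sum_cmat_empty`) and the marked pieces peeled first (`FK.sum_attachPat`), every coefficient table of census g39's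
  leaves (K₄: B1/B2, VEE\*, EEE; wheels; torsos) is a kernel-evaluable fold — cross-checked against g39's Python engine on
  B1, B2, VEE\*, EEE-triangle (1,560 (colouring, pattern) cases: patterns AND corrections agree; `decide +kernel` evaluates the
  480 B2+VEE\* cases in seconds).
[cite: Grimmett2006, §1.4 eq. (1.20) (p. 15); §3.8 (pp. 61–62)]
-/

namespace Summit.CriticalPhenomena.PercolationContinuityZ3.Theorems

namespace FK

open SimpleGraph Literature.Probability.LatticeModels Literature.Probability.Percolation
open scoped Classical

variable {V : Type*}

/-! ### The attachment step with contracted sets on BOTH sides (for peeling several piece minors in turn) -/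

section AttachCC

variable [Fintype V] {ι : Type*} {E₁ E₂ C₁ C₂ : Finset (Sym2 V)} {V₁ V₂ : Set V} {u v : V} {p : ι → V}

/-- **The attachment step under the configuration sum, BOTH SIDES READ AS MINORS** (host `(E₁, C₁)`, piece `(E₂, C₂)`): as
`FK.sum_attachPatC` of `…Pat3Attach`, with the host matrices `cmat p (γ₁ ∪ C₁)`.  Peeling the marked pieces of a shape one by one
keeps the not-yet-peeled pieces' contracted sets in the host — this is the form that iterates. [folklore] -/
theorem sum_attachPatCC {β : Type*} [AddCommMonoid β] (hd : Disjoint E₁ E₂)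
    (h₁ : ∀ e ∈ (↑(E₁ ∪ C₁) : Set (Sym2 V)), ∀ z ∈ e, z ∈ V₁) (h₂ : ∀ e ∈ (↑(E₂ ∪ C₂) : Set (Sym2 V)), ∀ z ∈ e, z ∈ V₂)
    (hS : V₁ ∩ V₂ ⊆ {u, v}) (huv : u ≠ v) {m : V} (hm : m ∉ V₁) (hmu : m ≠ u) (hmv : m ≠ v)
    (hp : ∀ a, p a ∈ V₂ → p a = u ∨ p a = v ∨ p a = m) {i j k : ι} (hi : p i = u) (hj : p j = v) (hk : p k = m)
    (s₀ : ℕ) (g : ℕ → (ι → ι → Bool) → (ι → ι → Bool) → β) :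
    ∑ γ ∈ (E₁ ∪ E₂).powerset,
        g (apExpC (E₁ ∪ E₂) (C₁ ∪ C₂) γ + 2 * Fintype.card V + s₀) (cmat p (γ ∪ (C₁ ∪ C₂)))
          (cmat p ((E₁ ∪ E₂) \ γ ∪ (C₁ ∪ C₂))) =
      ∑ γ₁ ∈ E₁.powerset, ∑ γ₂ ∈ E₂.powerset,
        g (apExpC E₁ C₁ γ₁ + apExpC E₂ C₂ γ₂ + (if cmat p (γ₁ ∪ C₁) i j && (pat3 (γ₂ ∪ C₂) u v m).xy then 1 else 0) +
            (if cmat p (E₁ \ γ₁ ∪ C₁) i j && (pat3 (E₂ \ γ₂ ∪ C₂) u v m).xy then 1 else 0) + s₀)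
          (attachPat (cmat p (γ₁ ∪ C₁)) i j k (pat3 (γ₂ ∪ C₂) u v m))
          (attachPat (cmat p (E₁ \ γ₁ ∪ C₁)) i j k (pat3 (E₂ \ γ₂ ∪ C₂) u v m)) := by
  rw [sum_powerset_union_disj hd]
  refine Finset.sum_congr rfl fun γ₁ hγ₁ => Finset.sum_congr rfl fun γ₂ hγ₂ => ?_
  have g₁ := Finset.mem_powerset.1 hγ₁
  have g₂ := Finset.mem_powerset.1 hγ₂
  have s₁ : ∀ {δ : Finset (Sym2 V)}, δ ⊆ E₁ → δ ∪ C₁ ⊆ E₁ ∪ C₁ := fun h => Finset.union_subset_union h (subset_refl _)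
  have s₂ : ∀ {δ : Finset (Sym2 V)}, δ ⊆ E₂ → δ ∪ C₂ ⊆ E₂ ∪ C₂ := fun h => Finset.union_subset_union h (subset_refl _)
  -- sets
  rw [union_sdiff_union hd g₁ g₂, Finset.union_union_union_comm γ₁ γ₂ C₁ C₂,
    Finset.union_union_union_comm (E₁ \ γ₁) (E₂ \ γ₂) C₁ C₂,
    cmat_union_eq_attachPat h₁ h₂ hS hm hmu hmv hp hi hj hk (s₁ g₁) (s₂ g₂),
    cmat_union_eq_attachPat h₁ h₂ hS hm hmu hmv hp hi hj hk (s₁ Finset.sdiff_subset) (s₂ Finset.sdiff_subset)]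
  -- levels: fk-2's parallel junction on both members
  have k1 := clusterCount_parallel h₁ h₂ hS (Finset.coe_subset.2 (s₁ g₁)) (Finset.coe_subset.2 (s₂ g₂)) huv
  have k2 := clusterCount_parallel h₁ h₂ hS (Finset.coe_subset.2 (s₁ (Finset.sdiff_subset (t := γ₁))))
    (Finset.coe_subset.2 (s₂ (Finset.sdiff_subset (t := γ₂)))) huv
  rw [ite_prop_eq_ite_bool
      (p := (openGraph (↑(γ₁ ∪ C₁) : BondConfig V)).Reachable u v ∧ (openGraph (↑(γ₂ ∪ C₂) : BondConfig V)).Reachable u v)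
      (bb := cmat p (γ₁ ∪ C₁) i j && (pat3 (γ₂ ∪ C₂) u v m).xy) (by rw [Bool.and_eq_true, cmat_iff, pat3_xy_iff, hi, hj])] at k1
  rw [ite_prop_eq_ite_bool
      (p := (openGraph (↑(E₁ \ γ₁ ∪ C₁) : BondConfig V)).Reachable u v ∧
        (openGraph (↑(E₂ \ γ₂ ∪ C₂) : BondConfig V)).Reachable u v)
      (bb := cmat p (E₁ \ γ₁ ∪ C₁) i j && (pat3 (E₂ \ γ₂ ∪ C₂) u v m).xy)
      (by rw [Bool.and_eq_true, cmat_iff, pat3_xy_iff, hi, hj])] at k2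
  have e : apExpC (E₁ ∪ E₂) (C₁ ∪ C₂) (γ₁ ∪ γ₂) + 2 * Fintype.card V =
      apExpC E₁ C₁ γ₁ + apExpC E₂ C₂ γ₂ + (if cmat p (γ₁ ∪ C₁) i j && (pat3 (γ₂ ∪ C₂) u v m).xy then 1 else 0) +
        (if cmat p (E₁ \ γ₁ ∪ C₁) i j && (pat3 (E₂ \ γ₂ ∪ C₂) u v m).xy then 1 else 0) := by
    unfold apExpC
    rw [union_sdiff_union hd g₁ g₂, Finset.union_union_union_comm γ₁ γ₂ C₁ C₂,
      Finset.union_union_union_comm (E₁ \ γ₁) (E₂ \ γ₂) C₁ C₂, Finset.coe_union, Finset.coe_union (E₁ \ γ₁ ∪ C₁)]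
    omega
  rw [e]

end AttachCC

/-! ### Plain skeleton edges: folding `attachBit` along a list of named edges -/

section Skeleton

variable [Fintype V] {ι : Type*}

/-- **Fold of `attachBit` along a list of named edges with their open/closed bits**, returning the final connectivity matrix
and the number of level corrections `1{ends already joined ∧ edge open}` (the cycle-closing open edges). [folklore] -/
def foldBits (R : ι → ι → Bool) : List (ι × ι × Bool) → (ι → ι → Bool) × ℕ
  | [] => (R, 0)
  | (i, j, b) :: L => ((foldBits (attachBit R i j b) L).1, (foldBits (attachBit R i j b) L).2 + (if R i j && b then 1 else 0))

/-- `foldBits` on a cons (definitional unfolding). [folklore] -/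
theorem foldBits_cons (R : ι → ι → Bool) (i j : ι) (b : Bool) (L : List (ι × ι × Bool)) :
    foldBits R ((i, j, b) :: L) =
      ((foldBits (attachBit R i j b) L).1, (foldBits (attachBit R i j b) L).2 + (if R i j && b then 1 else 0)) := rfl

variable (p : ι → V)

/-- The actual edge of a named edge. [folklore] -/
def pedge (e : ι × ι) : Sym2 V := s(p e.1, p e.2)

/-- The actual edge set of a list of named edges. [folklore] -/
noncomputable def plainSet (L : List (ι × ι)) : Finset (Sym2 V) := (L.map (pedge p)).toFinset

variable {p}

omit [Fintype V] in
/-- Injective names turn a duplicate-free list of NAMED edges (as unordered pairs of names) into a duplicate-free list of edges of `V`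
(the `Nodup` side condition of the skeleton lemmas, decidable on the names). [folklore] -/
theorem nodup_map_pedge (hinj : Function.Injective p) {L : List (ι × ι)} (h : (L.map fun e => s(e.1, e.2)).Nodup) :
    (L.map (pedge p)).Nodup := by
  have e : L.map (pedge p) = (L.map fun e => s(e.1, e.2)).map (Sym2.map p) := by
    rw [List.map_map]; rfl
  rw [e]
  exact h.map (Sym2.map.injective hinj)

omit [Fintype V] in
/-- `plainSet` of a cons. [folklore] -/
theorem plainSet_cons (e : ι × ι) (L : List (ι × ι)) : plainSet p (e :: L) = insert (pedge p e) (plainSet p L) := by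
  unfold plainSet; rw [List.map_cons, List.toFinset_cons]

omit [Fintype V] in
/-- The bit of the one-edge piece: `u ↔ v` in `δ ⊆ {uv}` iff `uv ∈ δ` (for `u ≠ v`). [folklore] -/
theorem conn_subset_singleton {u v : V} (huv : u ≠ v) {δ : Finset (Sym2 V)} (hδ : δ ⊆ {s(u, v)}) :
    conn δ u v = decide (s(u, v) ∈ δ) := by
  rcases Finset.subset_singleton_iff.1 hδ with h | h <;> rw [h]
  · have hb : ¬ (openGraph (↑(∅ : Finset (Sym2 V)) : BondConfig V)).Reachable u v := by
      have : openGraph (↑(∅ : Finset (Sym2 V)) : BondConfig V) = ⊥ := by rw [Finset.coe_empty, openGraph, fromEdgeSet_empty]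
      rw [this, reachable_bot]; exact huv
    rw [conn_of_not_reachable hb]; simp
  · have hb : (openGraph (↑({s(u, v)} : Finset (Sym2 V)) : BondConfig V)).Reachable u v := by
      refine SimpleGraph.Adj.reachable ((openGraph_adj _ u v).2 ⟨?_, huv⟩)
      rw [Finset.coe_singleton]; exact Set.mem_singleton _
    rw [conn_of_reachable hb]; simp

/-- The antipodal exponent of the one-edge network is `2|V| - 1` at both of its configurations. [folklore] -/
theorem apExp_subset_singleton {u v : V} (huv : u ≠ v) {δ : Finset (Sym2 V)} (hδ : δ ⊆ {s(u, v)}) :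
    apExp {s(u, v)} δ + 1 = 2 * Fintype.card V := by
  have k := clusterCount_union_pair_add (↑(∅ : Finset (Sym2 V)) : BondConfig V) u v
  have h0 : ¬ (openGraph (↑(∅ : Finset (Sym2 V)) : BondConfig V)).Reachable u v := by
    have : openGraph (↑(∅ : Finset (Sym2 V)) : BondConfig V) = ⊥ := by rw [Finset.coe_empty, openGraph, fromEdgeSet_empty]
    rw [this, reachable_bot]; exact huv
  rw [if_neg h0, Finset.coe_empty, Set.empty_union, clusterCount_empty_card] at k
  have kk : clusterCount (↑({s(u, v)} : Finset (Sym2 V)) : BondConfig V) ∅ + 1 = Fintype.card V := by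
    rw [Finset.coe_singleton]; exact k
  unfold apExp
  rcases Finset.subset_singleton_iff.1 hδ with h | h <;> rw [h]
  · rw [Finset.sdiff_empty, Finset.coe_empty, clusterCount_empty_card]; omega
  · rw [Finset.sdiff_self, Finset.coe_empty, clusterCount_empty_card]; omega

/-- **ONE PLAIN EDGE under the configuration sum**: adding the skeleton edge `uv ∉ E₁` (names `i, j`) splits each configuration by
the edge's bit; matrices by `attachBit`, level `+1 = + corrections`. [folklore] -/
theorem sum_insert_edge {β : Type*} [AddCommMonoid β] {E₁ : Finset (Sym2 V)} {u v : V} (huv : u ≠ v)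
    (he : s(u, v) ∉ E₁) {i j : ι} (hi : p i = u) (hj : p j = v) (s₀ : ℕ) (g : ℕ → (ι → ι → Bool) → (ι → ι → Bool) → β) :
    ∑ γ ∈ (insert s(u, v) E₁).powerset, g (apExp (insert s(u, v) E₁) γ + 1 + s₀) (cmat p γ) (cmat p (insert s(u, v) E₁ \ γ)) =
      ∑ γ₁ ∈ E₁.powerset, ∑ δ ∈ ({s(u, v)} : Finset (Sym2 V)).powerset,
        g (apExp E₁ γ₁ + (if cmat p γ₁ i j && decide (s(u, v) ∈ δ) then 1 else 0) +
            (if cmat p (E₁ \ γ₁) i j && !decide (s(u, v) ∈ δ) then 1 else 0) + s₀)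
          (attachBit (cmat p γ₁) i j (decide (s(u, v) ∈ δ))) (attachBit (cmat p (E₁ \ γ₁)) i j (!decide (s(u, v) ∈ δ))) := by
  have hd : Disjoint E₁ {s(u, v)} := Finset.disjoint_singleton_right.2 he
  have h₁ : ∀ e ∈ (↑E₁ : Set (Sym2 V)), ∀ z ∈ e, z ∈ (Set.univ : Set V) := fun _ _ _ _ => trivial
  have hS : (Set.univ : Set V) ∩ ({u, v} : Set V) ⊆ {u, v} := fun z hz => hz.2
  have hp : ∀ a, p a ∈ ({u, v} : Set V) → p a = u ∨ p a = v := fun a h => h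
  have key := sum_attachBit hd h₁ (edges_singleton_verts u v) hS huv hp hi hj s₀
    (fun n A B => g (n + 1 - 2 * Fintype.card V) A B)
  rw [Finset.insert_eq, Finset.union_comm]
  have hV : 1 ≤ Fintype.card V := Fintype.card_pos_iff.2 ⟨u⟩
  refine (Finset.sum_congr rfl fun γ _ => ?_).trans (key.trans (Finset.sum_congr rfl fun γ₁ hγ₁ =>
    Finset.sum_congr rfl fun δ hδ => ?_))
  · show _ = g (apExp (E₁ ∪ {s(u, v)}) γ + 2 * Fintype.card V + s₀ + 1 - 2 * Fintype.card V) _ _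
    congr 1; omega
  · have hδ' := Finset.mem_powerset.1 hδ
    have hc : ∀ δ' : Finset (Sym2 V), δ' ⊆ {s(u, v)} → conn δ' u v = decide (s(u, v) ∈ δ') := fun δ' h =>
      conn_subset_singleton huv h
    have hcc : conn ({s(u, v)} \ δ) u v = !decide (s(u, v) ∈ δ) := by
      rw [hc _ Finset.sdiff_subset]
      rcases Finset.subset_singleton_iff.1 hδ' with h | h <;> rw [h] <;> simp
    have ea := apExp_subset_singleton huv hδ'
    show g _ _ _ = g _ _ _
    rw [hc δ hδ', hcc]
    congr 1
    omega

/-- **Binary enumeration** of the `2^n` bit lists of length `n` (the skeleton colourings), computable. [folklore] -/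
def sumBits {β : Type*} [AddCommMonoid β] : ℕ → (List Bool → β) → β
  | 0, f => f []
  | n + 1, f => sumBits n (fun bs => f (false :: bs)) + sumBits n (fun bs => f (true :: bs))

/-- Named edges decorated with a list of bits. [folklore] -/
def zipBits (L : List (ι × ι)) (bs : List Bool) : List (ι × ι × Bool) := List.zipWith (fun e b => (e.1, e.2, b)) L bs

/-- `zipBits` on conses (definitional). [folklore] -/
theorem zipBits_cons (e : ι × ι) (L : List (ι × ι)) (b : Bool) (bs : List Bool) :
    zipBits (e :: L) (b :: bs) = (e.1, e.2, b) :: zipBits L bs := rfl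

omit [Fintype V] in
/-- A sum over the configurations of the one-edge network is a two-term sum over its bit. [folklore] -/
theorem sum_powerset_singleton_bit {β : Type*} [AddCommMonoid β] (f : Sym2 V) (h : Bool → β) :
    ∑ δ ∈ ({f} : Finset (Sym2 V)).powerset, h (decide (f ∈ δ)) = h false + h true := by
  rw [← Finset.insert_empty, Finset.sum_powerset_insert (by simp), Finset.powerset_empty, Finset.sum_singleton,
    Finset.sum_singleton]
  simp

/-- **ALL PLAIN EDGES under the configuration sum**: peeling the skeleton edges of the list `L` (distinct actual edges, no loops,
none in the host `E₁`) one by one — the configuration sum over `E₁ ∪ plainSet L` is the sum over host configurations `γ₁` and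
bit lists `bs` (the skeleton colourings, `FK.sumBits`) of the summand read on `foldBits` of the two host matrices (bits `bs` / their
negations), the level shifted by the two correction counts (`+ |L|` on the left absorbs the one-edge networks' own exponents
`2|V| - 1`). [folklore] -/
theorem sum_plainList {β : Type*} [AddCommMonoid β] (L : List (ι × ι)) {E₁ : Finset (Sym2 V)}
    (hL : ∀ e ∈ L, p e.1 ≠ p e.2) (hnd : (L.map (pedge p)).Nodup) (hdis : ∀ e ∈ L, pedge p e ∉ E₁)
    (s₀ : ℕ) (g : ℕ → (ι → ι → Bool) → (ι → ι → Bool) → β) :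
    ∑ γ ∈ (E₁ ∪ plainSet p L).powerset,
        g (apExp (E₁ ∪ plainSet p L) γ + L.length + s₀) (cmat p γ) (cmat p ((E₁ ∪ plainSet p L) \ γ)) =
      ∑ γ₁ ∈ E₁.powerset, sumBits L.length fun bs =>
        g (apExp E₁ γ₁ + (foldBits (cmat p γ₁) (zipBits L bs)).2 +
              (foldBits (cmat p (E₁ \ γ₁)) (zipBits L (bs.map (! ·)))).2 + s₀)
          (foldBits (cmat p γ₁) (zipBits L bs)).1 (foldBits (cmat p (E₁ \ γ₁)) (zipBits L (bs.map (! ·)))).1 := by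
  induction L generalizing E₁ s₀ g with
  | nil =>
    have h0 : plainSet p ([] : List (ι × ι)) = (∅ : Finset (Sym2 V)) := rfl
    simp only [h0, Finset.union_empty, List.length_nil, add_zero, sumBits, zipBits, List.zipWith, foldBits]
  | cons e L ih =>
    obtain ⟨i, j⟩ := e
    have hij : p i ≠ p j := hL (i, j) List.mem_cons_self
    have hnd' : (L.map (pedge p)).Nodup := (List.nodup_cons.1 (by simpa using hnd)).2
    have hnotin : pedge p (i, j) ∉ L.map (pedge p) := (List.nodup_cons.1 (by simpa using hnd)).1
    have heE : s(p i, p j) ∉ E₁ := hdis (i, j) List.mem_cons_self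
    have hdis' : ∀ e ∈ L, pedge p e ∉ insert s(p i, p j) E₁ := fun e he h => by
      rcases Finset.mem_insert.1 h with h | h
      · exact hnotin (List.mem_map.2 ⟨e, he, h⟩)
      · exact hdis e (List.mem_cons_of_mem _ he) h
    have hL' : ∀ e ∈ L, p e.1 ≠ p e.2 := fun e he => hL e (List.mem_cons_of_mem _ he)
    -- regroup the host: `E₁ ∪ plainSet (e :: L) = (insert e E₁) ∪ plainSet L`, and use the induction hypothesis
    have hE : E₁ ∪ plainSet p ((i, j) :: L) = insert s(p i, p j) E₁ ∪ plainSet p L := by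
      rw [plainSet_cons, Finset.union_insert, Finset.insert_union]; rfl
    rw [hE, List.length_cons]
    have step1 := ih hL' hnd' hdis' (1 + s₀) g
    rw [Finset.sum_congr rfl fun γ _ => show g (apExp (insert s(p i, p j) E₁ ∪ plainSet p L) γ + (L.length + 1) + s₀)
        (cmat p γ) (cmat p ((insert s(p i, p j) E₁ ∪ plainSet p L) \ γ)) =
        g (apExp (insert s(p i, p j) E₁ ∪ plainSet p L) γ + L.length + (1 + s₀))
        (cmat p γ) (cmat p ((insert s(p i, p j) E₁ ∪ plainSet p L) \ γ)) by congr 1; ring, step1]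
    -- peel the edge `e` off the host `insert e E₁`
    have step2 := sum_insert_edge (p := p) hij heE (i := i) (j := j) rfl rfl s₀
      (fun n A B => sumBits L.length fun bs =>
        g (n + (foldBits A (zipBits L bs)).2 + (foldBits B (zipBits L (bs.map (! ·)))).2)
          (foldBits A (zipBits L bs)).1 (foldBits B (zipBits L (bs.map (! ·)))).1)
    rw [Finset.sum_congr rfl fun γ _ => show (sumBits L.length fun bs =>
        g (apExp (insert s(p i, p j) E₁) γ + (foldBits (cmat p γ) (zipBits L bs)).2 +
              (foldBits (cmat p (insert s(p i, p j) E₁ \ γ)) (zipBits L (bs.map (! ·)))).2 + (1 + s₀))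
          (foldBits (cmat p γ) (zipBits L bs)).1 (foldBits (cmat p (insert s(p i, p j) E₁ \ γ)) (zipBits L (bs.map (! ·)))).1) =
        (sumBits L.length fun bs =>
          g (apExp (insert s(p i, p j) E₁) γ + 1 + s₀ + (foldBits (cmat p γ) (zipBits L bs)).2 +
              (foldBits (cmat p (insert s(p i, p j) E₁ \ γ)) (zipBits L (bs.map (! ·)))).2)
            (foldBits (cmat p γ) (zipBits L bs)).1 (foldBits (cmat p (insert s(p i, p j) E₁ \ γ)) (zipBits L (bs.map (! ·)))).1)
      by congr 1; funext bs; congr 1; ring, step2]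
    -- the one-edge piece's configurations are its two bits
    refine Finset.sum_congr rfl fun γ₁ _ => ?_
    rw [sum_powerset_singleton_bit (s(p i, p j)) fun b => sumBits L.length fun bs =>
      g (apExp E₁ γ₁ + (if cmat p γ₁ i j && b then 1 else 0) + (if cmat p (E₁ \ γ₁) i j && !b then 1 else 0) + s₀ +
            (foldBits (attachBit (cmat p γ₁) i j b) (zipBits L bs)).2 +
            (foldBits (attachBit (cmat p (E₁ \ γ₁)) i j (!b)) (zipBits L (bs.map (! ·)))).2)
        (foldBits (attachBit (cmat p γ₁) i j b) (zipBits L bs)).1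
        (foldBits (attachBit (cmat p (E₁ \ γ₁)) i j (!b)) (zipBits L (bs.map (! ·)))).1]
    simp only [sumBits, List.map_cons, zipBits_cons, foldBits_cons, Bool.not_false, Bool.not_true]
    congr 1 <;> (congr 1; funext bs; congr 1; ring)

end Skeleton

end FK

end Summit.CriticalPhenomena.PercolationContinuityZ3.Theorems
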